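import Summits.BirchSwinnertonDyer.BirchSwinnertonDyer.Theorems.GenusKolyvaginAtTwoShaCardDvdPowAtTwoPosTRegularSignedStepB
import HarnessLib

/-!
# Route `GenusKolyvaginAtTwo`, U⁺_T `ShaCardDvdPowAtTwoPosT` (stmt-BirchSwinnertonDyer-23378, Δ > 0) — the ONE missing lemma of B2Q⁺:
# McCallum's Čebotarev with EXACT local orders at a REGULAR Kolyvagin prime, for SIGNED (τ-EIGEN) families `σ_* c_i = ± c_i` — PART B (§3–§5:
# `ℚ`-side packaging, the both-sign-lossless regular element, END-TO-END); PART A (§1–§2) = `…PosTRegularSignedStepB`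

Seat `bsd-line-gk2-p4` g23 (WIDTH-5 attach, cell `bsd-f1-sign2`), `--supports stmt-BirchSwinnertonDyer-23378 --as helper`.
THEOREMS ONLY (no definition, no named fact, no `sorry`).  BSD is NOT proved by any of this; U⁺_T / Q4_T are NOT claimed; nothing is closed.

WHY.  gk2-p5 g31's B2Q±-FRAME (LINE 19's sharp exponent over `ℚ` re-assembled sign-free: STATUS 2026-08-30T00:26Z/00:35Z) consumes, besides
tree theorems, exactly ONE missing input: a Kolyvagin prime `ℓ` whose Frobenius acts on `E[2^{n+1}]` as a REGULAR involution `h` (cyclic frames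
`(1 ± h)E[2^{n+1}] ≅ ℤ/2^{n+1}`, no lost bit on `Δ > 0`, unlike `c₀`-primes) at which TWO EIGENCLASSES of OPPOSITE τ-signs — the `ℚ`-Selmer class `s`
(`σ_* s = s`) and the Heegner class `y = c_M(1)` (`σ_* y = −y`) — have prescribed EXACT local orders.  The sibling crux 23716's landed engine
(`OffBigImageOddLocalAtTwo.Engine.exists_regular_kolyvaginPrime_of_supply`, fkl lead g0) does this for UNSIGNED `σ`-stable families `σ_* c_i = c_{π i}`
(an anti-invariant class fits that shape only as the dependent pair `{y, −y}`); GK2's `…EquivariantChebotarevAtTwoSigned` does SIGNED families but at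
`c₀`-primes (`Δ < 0`).  This file merges the two for `π = id` (McCallum's printed eigenclass case):
* §1 algebra — the MINUS side of the regular involution `reg b = [[1,1],[0,−1]]`: `two_pow_smul_basis_one_sub_reg_ne_zero` (`b₁ − reg b₁` has full order;
  `ker(reg + 1) = im(1 − reg)` is the fkl lead's `Engine.exists_eq_sub_reg_of_reg_eq_neg`, imported); and Step B targets with SIGNS AND CONSTANTS
  `exists_orders_regular_signed` (`κ_i + s_i A x_i + x_i` of exact order `2^{N_i}`, given `A κ_i = s_i κ_i`, `ker(A ∓ 1) = im(A ± 1)`, `P ± AP` of full order);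
* §2 the signed Galois-element producer at a regular element `exists_h1Eval_conj_mul_order_regular_signed` (the engine's §H with
  `h1Eval_conjGalCMH_of_signStable` in place of `…_of_tauStable`: value `[c_i, (ρ₀ n m)^τ(ρ₀ n m)] = κ_i + s_i A[c_i, n] + [c_i, n]`);
* §3 its `ℚ`-side packaging `exists_galoisElement_regular_rat_signed`; §4 the regular element with BOTH-sign losslessness
  `exists_regular_galoisElement_of_supply_signed`; §5 END-TO-END `exists_regular_kolyvaginPrime_of_supply_signed` / `…_of_heegner_signed`
  (Steps C–H = the engine's `exists_kolyvaginPrime_gt_two_of_galoisElement_regular`, unchanged): output shape = the engine's / GK2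
  `GenusRegularSupply.regularKolyvaginSupplyAtTwo_proof`, for eigen families.
Consumer: g31's B2Q±-FRAME with `r = 2`, `cs = (ι_* res s, ι_* y)`, `sgn = (1, −1)` (independent case; the dependent case — common socle — reduces to
`r = 1` exactly as in gk2-p2's `…RTFullOrderPairChebotarev`).

References: [McCallumLMS1991] §3 (2), Prop. 3.1, Cor. 3.2; [GrossLMS1991] §3 (3.1)–(3.3), §9 Prop. 9.3; [Kolyvagin1989Izv] §3.
-/

set_option autoImplicit false
-- the Theorems namespace of this sub repeats the summit name by design (D-0017 nested layout)
set_option linter.dupNamespace false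

noncomputable section

namespace Summit.BirchSwinnertonDyer.BirchSwinnertonDyer.Theorems.GenusExact.RegularSigned

open scoped Classical
open WeierstrassCurve Field Finset
open Literature.NumberTheory.EllipticCurves
open Summit.BirchSwinnertonDyer.BirchSwinnertonDyer.Theorems.GenusExact
open Summit.BirchSwinnertonDyer.BirchSwinnertonDyer.Theorems.OffBigImageOddLocalAtTwo.Engine

/-! ## §3 The `ℚ`-side packaging of the signed producer -/

section StepBSignedRat

open scoped Pointwise
open NumberField Literature.NumberTheory.GaloisRepresentations Literature.NumberTheory

universe u

variable {W : WeierstrassCurve ℚ} {K : Type u} [Field K] [NumberField K]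

/-- **Signed Step B at a REGULAR element, `ℚ`-side packaging** (the engine's `exists_galoisElement_regular_rat` for eigen families): `K` imaginary
quadratic, `c₀` a complex conjugation (transport lifting `c ≠ 1`), `ρ₀ ∈ Γ_K` with `h₀ := c₀ · res ρ₀` an involution on `E(ℚ̄)[2^M]` (`hsq`) that is
LOSSLESS FOR BOTH SIGNS: `P + h₀P` and `P − h₀P` of full order (`hP1p`, `hP1m`), `ker(h₀ − 1) = im(h₀ + 1)` and `ker(h₀ + 1) = im(1 − h₀)` on each
`E[2^e]` (`hkerp`, `hkerm`).  Then for EIGENCLASSES `σ_* cs_i = s_i cs_i` (independent, detected on `Γ_{K(E[2^M])}`) there is `ρ ∈ Γ_K` with the SAME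
action `c₀ · res ρ = h₀` on `E(ℚ̄)[2^M]` and exact orders `ord [cs_i, (ρ m)^t (ρ m)] = 2^{N_i}` for all `m ∈ 𝒩` — the hypothesis `hρ` of the engine's
Steps C–H `exists_kolyvaginPrime_gt_two_of_galoisElement_regular`.  (Proof = the engine's, with §2 in place of its unsigned producer.)
[cite: McCallumLMS1991, §3 (2), Prop. 3.1] [cite: GrossLMS1991, §9 Prop. 9.3] -/
theorem exists_galoisElement_regular_rat_signed [W.IsElliptic] (hK : IsImaginaryQuadratic K) {M : ℕ}
    (hM : 1 ≤ M) {c₀ : absoluteGaloisGroup ℚ} (hc₀ : IsComplexConjugation (Rat.castHom ℝ) c₀)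
    {c : K ≃ₐ[ℚ] K} (hc : c ≠ 1)
    (hS : ∀ H : AddSubgroup (geomTorsion (W.baseChange K) 2),
      (∀ g : absoluteGaloisGroup K, ∀ t ∈ H, g • t ∈ H) → H = ⊥ ∨ H = ⊤)
    (hC : ∀ f : geomTorsion (W.baseChange K) 2 →+ geomTorsion (W.baseChange K) 2,
      (∀ (g : absoluteGaloisGroup K) (t : geomTorsion (W.baseChange K) 2), f (g • t) = g • f t) →
        ∃ c : ℤ, ∀ t, f t = c • t)
    (ρ₀ : absoluteGaloisGroup K)
    (hsq : ∀ X : geomTorsion W ((2 ^ M : ℕ) : ℤ),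
      (c₀ * absGaloisRestrict ℚ K ρ₀) • (c₀ * absGaloisRestrict ℚ K ρ₀) • X = X)
    {P : geomTorsion W ((2 ^ M : ℕ) : ℤ)}
    (hP1p : M ≠ 0 → (2 : ℤ) ^ (M - 1) • (P + (c₀ * absGaloisRestrict ℚ K ρ₀) • P) ≠ 0)
    (hP1m : M ≠ 0 → (2 : ℤ) ^ (M - 1) • (P - (c₀ * absGaloisRestrict ℚ K ρ₀) • P) ≠ 0)
    (hkerp : ∀ (e : ℕ) (X : geomTorsion W ((2 ^ M : ℕ) : ℤ)), e ≤ M → (2 : ℤ) ^ e • X = 0 →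
      (c₀ * absGaloisRestrict ℚ K ρ₀) • X = X →
        ∃ Y : geomTorsion W ((2 ^ M : ℕ) : ℤ), (2 : ℤ) ^ e • Y = 0 ∧
          X = Y + (c₀ * absGaloisRestrict ℚ K ρ₀) • Y)
    (hkerm : ∀ (e : ℕ) (X : geomTorsion W ((2 ^ M : ℕ) : ℤ)), e ≤ M → (2 : ℤ) ^ e • X = 0 →
      (c₀ * absGaloisRestrict ℚ K ρ₀) • X = -X →
        ∃ Y : geomTorsion W ((2 ^ M : ℕ) : ℤ), (2 : ℤ) ^ e • Y = 0 ∧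
          X = Y - (c₀ * absGaloisRestrict ℚ K ρ₀) • Y)
    {ι : Type*} [Fintype ι] {cs : ι → galH1Torsion (W.baseChange K) ((2 ^ M : ℕ) : ℤ)} {sgn : ι → ℤ}
    (hsgn : ∀ i, sgn i = 1 ∨ sgn i = -1) (hcs : ∀ i, conjAct W c ((2 ^ M : ℕ) : ℤ) (cs i) = sgn i • cs i)
    (e : ι → ℕ) (he : ∀ i, ((2 : ℤ) ^ e i) • cs i = 0)
    (hind : ∀ a : ι → ℤ, ∑ i, a i • cs i = 0 → ∀ i, ((2 : ℤ) ^ e i) ∣ a i)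
    (hres : ∀ a : ι → ℤ, (∀ ρ ∈ torsionFixing (W.baseChange K) ((2 ^ M : ℕ) : ℤ),
      h1Eval (W.baseChange K) ((2 ^ M : ℕ) : ℤ) (∑ i, a i • cs i) ρ = 0) → ∑ i, a i • cs i = 0)
    (Nv : ι → ℕ) (hNe : ∀ i, Nv i ≤ e i) (heM : ∀ i, e i ≤ M) :
    ∃ ρ : absoluteGaloisGroup K,
      (∀ X : geomTorsion W ((2 ^ M : ℕ) : ℤ),
        (c₀ * absGaloisRestrict ℚ K ρ) • X = (c₀ * absGaloisRestrict ℚ K ρ₀) • X) ∧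
      (∀ X : geomTorsion W ((2 ^ M : ℕ) : ℤ),
        (c₀ * absGaloisRestrict ℚ K ρ) • (c₀ * absGaloisRestrict ℚ K ρ) • X = X) ∧
      ∀ m ∈ evalKer (W.baseChange K) ((2 ^ M : ℕ) : ℤ) cs, ∀ i,
        ((2 : ℤ) ^ Nv i) • h1Eval (W.baseChange K) ((2 ^ M : ℕ) : ℤ) (cs i)
            ((RatClosure.isLiftOfAut_absGaloisTransport_of_isImaginaryQuadratic hK hc hc₀).conjGalCMH
              (ρ * m) * (ρ * m)) = 0 ∧
          (Nv i ≠ 0 → ((2 : ℤ) ^ (Nv i - 1)) • h1Eval (W.baseChange K) ((2 ^ M : ℕ) : ℤ) (cs i)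
            ((RatClosure.isLiftOfAut_absGaloisTransport_of_isImaginaryQuadratic hK hc hc₀).conjGalCMH
              (ρ * m) * (ρ * m)) ≠ 0) := by
  classical
  have h2n : (2 : ℤ) ∣ ((2 ^ M : ℕ) : ℤ) := by
    rw [Nat.cast_pow]; exact dvd_pow_self _ (by omega)
  set t : AlgebraicClosure K ≃+* AlgebraicClosure K :=
    (absGaloisTransport (K := ℚ) (L := K) c₀).toRingEquiv with ht_def
  have ht : IsLiftOfAut c t :=
    RatClosure.isLiftOfAut_absGaloisTransport_of_isImaginaryQuadratic hK hc hc₀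
  have hinv : ∀ x, t (t x) = x := fun x ↦
    RatClosure.absGaloisTransport_absGaloisTransport_of_sq_eq_one hc₀.sq_eq_one x
  have hk₀ : ht.conjGalCMH ρ₀ * ρ₀ ∈ torsionFixing (W.baseChange K) ((2 ^ M : ℕ) : ℤ) :=
    conjGal_mul_mem_torsionFixing_of_smul_smul hc₀ ht ρ₀ hsq
  set eq := RatClosure.torsionEquiv (K := K) W ((2 ^ M : ℕ) : ℤ) with heq
  -- the transport of `h₀`: `eq (h₀ X) = ρ₀⁻¹ • τ (eq X)`
  have hB : ∀ X : geomTorsion W ((2 ^ M : ℕ) : ℤ), eq ((c₀ * absGaloisRestrict ℚ K ρ₀) • X) =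
      ρ₀⁻¹ • ht.torsionMap W ((2 ^ M : ℕ) : ℤ) (eq X) := fun X ↦ by
    rw [mul_smul, heq, RatClosure.torsionEquiv_smul_of_lift W ht c₀ (fun _ ↦ rfl),
      RatClosure.torsionEquiv_smul, inv_smul_torsionMap_eq_of_conjGal_mul_mem W ht hinv ρ₀ hk₀]
  have hT : ∀ Q : geomTorsion (W.baseChange K) ((2 ^ M : ℕ) : ℤ), (2 : ℤ) ^ M • Q = 0 := fun Q ↦ by
    have h := (mem_geomTorsion_iff _ ((2 ^ M : ℕ) : ℤ) _).mp Q.2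
    have hc : (2 : ℤ) ^ M = ((2 ^ M : ℕ) : ℤ) := by push_cast; rfl
    apply Subtype.ext
    rw [AddSubgroupClass.coe_zsmul, ZeroMemClass.coe_zero, hc]
    exact h
  have hPM : (2 : ℤ) ^ M • eq P = 0 := hT _
  have hP1p' : M ≠ 0 →
      (2 : ℤ) ^ (M - 1) • (eq P + ρ₀⁻¹ • ht.torsionMap W ((2 ^ M : ℕ) : ℤ) (eq P)) ≠ 0 := by
    intro hM0 h
    rw [← hB, ← map_add, ← map_zsmul, map_eq_zero_iff _ eq.injective] at h
    exact hP1p hM0 h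
  have hP1m' : M ≠ 0 →
      (2 : ℤ) ^ (M - 1) • (eq P - ρ₀⁻¹ • ht.torsionMap W ((2 ^ M : ℕ) : ℤ) (eq P)) ≠ 0 := by
    intro hM0 h
    rw [← hB, ← map_sub, ← map_zsmul, map_eq_zero_iff _ eq.injective] at h
    exact hP1m hM0 h
  have hkerp' : ∀ (d : ℕ) (s : geomTorsion (W.baseChange K) ((2 ^ M : ℕ) : ℤ)), d ≤ M →
      (2 : ℤ) ^ d • s = 0 → ρ₀⁻¹ • ht.torsionMap W ((2 ^ M : ℕ) : ℤ) s = s →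
        ∃ y : geomTorsion (W.baseChange K) ((2 ^ M : ℕ) : ℤ), (2 : ℤ) ^ d • y = 0 ∧
          s = y + ρ₀⁻¹ • ht.torsionMap W ((2 ^ M : ℕ) : ℤ) y := by
    intro d s hd hds hfix
    obtain ⟨X, rfl⟩ := eq.surjective s
    rw [← hB, eq.injective.eq_iff] at hfix
    rw [← map_zsmul, map_eq_zero_iff _ eq.injective] at hds
    obtain ⟨Y, hY, hXY⟩ := hkerp d X hd hds hfix
    refine ⟨eq Y, by rw [← map_zsmul, hY, map_zero], ?_⟩
    rw [← hB, ← map_add, ← hXY]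
  have hkerm' : ∀ (d : ℕ) (s : geomTorsion (W.baseChange K) ((2 ^ M : ℕ) : ℤ)), d ≤ M →
      (2 : ℤ) ^ d • s = 0 → ρ₀⁻¹ • ht.torsionMap W ((2 ^ M : ℕ) : ℤ) s = -s →
        ∃ y : geomTorsion (W.baseChange K) ((2 ^ M : ℕ) : ℤ), (2 : ℤ) ^ d • y = 0 ∧
          s = y - ρ₀⁻¹ • ht.torsionMap W ((2 ^ M : ℕ) : ℤ) y := by
    intro d s hd hds hfix
    obtain ⟨X, rfl⟩ := eq.surjective s
    rw [← hB, ← map_neg, eq.injective.eq_iff] at hfix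
    rw [← map_zsmul, map_eq_zero_iff _ eq.injective] at hds
    obtain ⟨Y, hY, hXY⟩ := hkerm d X hd hds hfix
    refine ⟨eq Y, by rw [← map_zsmul, hY, map_zero], ?_⟩
    rw [← hB, ← map_sub, ← hXY]
  obtain ⟨nn, hnn, H⟩ := exists_h1Eval_conj_mul_order_regular_signed W ht hinv h2n hS hC ρ₀ hk₀ hPM hP1p' hP1m'
    hkerp' hkerm' hsgn hcs e he hind hres Nv hNe heM
  refine ⟨ρ₀ * nn, fun X ↦ mul_absGaloisRestrict_mul_smul_eq c₀ hnn X, fun X ↦ ?_, H⟩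
  rw [mul_absGaloisRestrict_mul_smul_eq c₀ hnn, mul_absGaloisRestrict_mul_smul_eq c₀ hnn, hsq]

end StepBSignedRat

/-! ## §4 The regular element `[[1,1],[0,−1]]` with BOTH-SIGN losslessness -/

section RegularElementSigned

open WeierstrassCurve NumberField IsDedekindDomain Field
open Literature.NumberTheory.GaloisRepresentations Literature.NumberTheory.EllipticCurves Literature.NumberTheory
open Summit.BirchSwinnertonDyer.BirchSwinnertonDyer.Theorems

universe u

variable {W : WeierstrassCurve ℚ} {K : Type u} [Field K] [NumberField K]

/-- **The regular element for SIGNED families** (the engine's `exists_regular_galoisElement_of_supply` with the two MINUS-side outputs added):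
`h₀ := c₀ · res ρ₀` acting on `E[2^{n+1}]` as `reg b = [[1,1],[0,−1]]` — an involution (`hsq`) with `2^n (P + h₀P) ≠ 0` AND `2^n (P − h₀P) ≠ 0`
(`P = b₁`: `P + h₀P = b₀`, `P − h₀P = 2b₁ − b₀`), `ker(h₀ − 1) = im(h₀ + 1)` AND `ker(h₀ + 1) = im(1 − h₀)` on every `E[2^e]` (§1a), and inverting
`μ_{2^{n+1}}` (`det = −1`). [folklore] -/
theorem exists_regular_galoisElement_of_supply_signed [W.IsElliptic] (n : ℕ) (c₀ : absoluteGaloisGroup ℚ)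
    (hsup : ∀ A : AddAut (geomTorsion W ((2 ^ (n + 1) : ℕ) : ℤ)),
      ∃ ρ₀ : absoluteGaloisGroup K, ∀ P : geomTorsion W ((2 ^ (n + 1) : ℕ) : ℤ),
        (c₀ * absGaloisRestrict ℚ K ρ₀) • P = A P) :
    ∃ ρ₀ : absoluteGaloisGroup K, ∃ P : geomTorsion W ((2 ^ (n + 1) : ℕ) : ℤ),
      (∀ X : geomTorsion W ((2 ^ (n + 1) : ℕ) : ℤ),
          (c₀ * absGaloisRestrict ℚ K ρ₀) • (c₀ * absGaloisRestrict ℚ K ρ₀) • X = X) ∧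
      ((2 : ℤ) ^ n • (P + (c₀ * absGaloisRestrict ℚ K ρ₀) • P) ≠ 0) ∧
      ((2 : ℤ) ^ n • (P - (c₀ * absGaloisRestrict ℚ K ρ₀) • P) ≠ 0) ∧
      (∀ (e : ℕ) (X : geomTorsion W ((2 ^ (n + 1) : ℕ) : ℤ)), (2 : ℤ) ^ e • X = 0 →
          (c₀ * absGaloisRestrict ℚ K ρ₀) • X = X →
          ∃ Y : geomTorsion W ((2 ^ (n + 1) : ℕ) : ℤ),
            (2 : ℤ) ^ e • Y = 0 ∧ X = Y + (c₀ * absGaloisRestrict ℚ K ρ₀) • Y) ∧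
      (∀ (e : ℕ) (X : geomTorsion W ((2 ^ (n + 1) : ℕ) : ℤ)), (2 : ℤ) ^ e • X = 0 →
          (c₀ * absGaloisRestrict ℚ K ρ₀) • X = -X →
          ∃ Y : geomTorsion W ((2 ^ (n + 1) : ℕ) : ℤ),
            (2 : ℤ) ^ e • Y = 0 ∧ X = Y - (c₀ * absGaloisRestrict ℚ K ρ₀) • Y) ∧
      (∀ σ : absoluteGaloisGroup ℚ,
          (∀ X : geomTorsion W ((2 ^ (n + 1) : ℕ) : ℤ), σ • X = (c₀ * absGaloisRestrict ℚ K ρ₀) • X) →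
          ∀ ζ : AlgebraicClosure ℚ, ζ ^ (2 ^ (n + 1)) = 1 → σ • ζ = ζ⁻¹) := by
  letI : Module (ZMod (2 ^ (n + 1))) (geomTorsion W ((2 ^ (n + 1) : ℕ) : ℤ)) :=
    AddSubgroup.torsionBy.zmodModule
  haveI : NeZero (2 ^ (n + 1)) := ⟨pow_ne_zero _ two_ne_zero⟩
  obtain ⟨b⟩ := nonempty_basis_geomTorsion W (2 ^ (n + 1))
  obtain ⟨ρ₀, hρ₀⟩ := hsup (regAut b)
  simp only [regAut_apply] at hρ₀
  refine ⟨ρ₀, b 1, fun X ↦ ?_, ?_, ?_, fun e X heX hfix ↦ ?_, fun e X heX hfix ↦ ?_, fun σ hσ ζ hζ ↦ ?_⟩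
  · rw [hρ₀, hρ₀, reg_reg]
  · rw [hρ₀, basis_one_add_reg]
    exact zsmul_basis_ne_zero b (two_pow_ne_zero_zmod n) 0
  · rw [hρ₀]
    exact two_pow_smul_basis_one_sub_reg_ne_zero b
  · rw [hρ₀] at hfix
    obtain ⟨Y, hY, hXY⟩ := exists_eq_add_reg_of_reg_eq b heX hfix
    exact ⟨Y, hY, by rw [hρ₀]; exact hXY⟩
  · rw [hρ₀] at hfix
    obtain ⟨Y, hY, hXY⟩ := exists_eq_sub_reg_of_reg_eq_neg b heX hfix
    exact ⟨Y, hY, by rw [hρ₀]; exact hXY⟩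
  · refine smul_eq_inv_of_det_repr_eq_neg_one W Nat.prime_two n b ?_ ζ hζ
    rw [hσ, hσ, hρ₀, hρ₀]
    exact det_reg b

end RegularElementSigned

/-! ## §5 END-TO-END: a regular Kolyvagin prime with exact local orders for a SIGNED eigen family -/

section EndToEndSigned

open scoped Classical Pointwise
open WeierstrassCurve NumberField IsDedekindDomain Field
open Literature.NumberTheory.GaloisRepresentations Literature.NumberTheory.EllipticCurves
open Literature.NumberTheory
open Rat.HeightOneSpectrum
open Summit.BirchSwinnertonDyer.BirchSwinnertonDyer.Theorems

universe u

variable {W : WeierstrassCurve ℚ} {K : Type u} [Field K] [NumberField K]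

/-- **THE REGULAR KOLYVAGIN PRIME FOR A SIGNED EIGEN FAMILY (E-port end-to-end, signed).**  `E/ℚ` globally minimal, `K` imaginary quadratic,
`c₀` a complex conjugation, `c ≠ 1`, the image tokens `hS`/`hC` on `E(K̄)[2]`, the full-image supply `hsup` on `E[2^{n+1}]`, and EIGENCLASSES
`cs_i ∈ H¹(K, E[2^{n+1}])`, `σ_* cs_i = s_i cs_i` (`s_i = ±1`), killed by `2^{e_i}`, independent, detected on `Γ_{K(E[2^{n+1}])}`, targets
`Nv_i ≤ e_i ≤ n+1`.  THEN: `ρ ∈ Γ_K` with `h := c₀ · res ρ` an involution on `E[2^{n+1}]`, inverting `μ_{2^{n+1}}`, LOSSLESS for BOTH signs (`P ± hP`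
of full order, both kernel conditions), and beyond every bound a prime `ℓ ∤ 2 N d_K`, `(ℓ)` inert in `K`, an arithmetic Frobenius acting on
`E[2^{n+1}]` as `h` and on `K` as `c₀`, `2^{n+1} ∣ ℓ + 1`, `2^{n+1} ∣ a_ℓ`, and `ord cs_{i,λ} = 2^{Nv_i}` EXACTLY at `λ ∋ ℓ`.
(§4 → §3 → the engine's Steps C–H `exists_kolyvaginPrime_gt_two_of_galoisElement_regular`.)  Conditional only on the displayed tree theorem-token
`hCheb : Automorphic.chebotarev_artinRep`. [cite: GrossLMS1991, §3 (3.1)–(3.3), §9 Prop. 9.3] [cite: McCallumLMS1991, §3 Cor. 3.2] -/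
theorem exists_regular_kolyvaginPrime_of_supply_signed (hCheb : Automorphic.chebotarev_artinRep) {N : ℕ}
    [NeZero N] [W.IsElliptic] [W.IsGloballyMinimal] (hK : IsImaginaryQuadratic K) (n : ℕ)
    {c₀ : absoluteGaloisGroup ℚ} (hc₀ : IsComplexConjugation (Rat.castHom ℝ) c₀)
    (hsup : ∀ A : AddAut (geomTorsion W ((2 ^ (n + 1) : ℕ) : ℤ)),
      ∃ ρ₀ : absoluteGaloisGroup K, ∀ P : geomTorsion W ((2 ^ (n + 1) : ℕ) : ℤ),
        (c₀ * absGaloisRestrict ℚ K ρ₀) • P = A P)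
    {c : K ≃ₐ[ℚ] K} (hc : c ≠ 1)
    (hS : ∀ H : AddSubgroup (geomTorsion (W.baseChange K) 2),
      (∀ g : absoluteGaloisGroup K, ∀ t ∈ H, g • t ∈ H) → H = ⊥ ∨ H = ⊤)
    (hC : ∀ f : geomTorsion (W.baseChange K) 2 →+ geomTorsion (W.baseChange K) 2,
      (∀ (g : absoluteGaloisGroup K) (t : geomTorsion (W.baseChange K) 2), f (g • t) = g • f t) →
        ∃ c : ℤ, ∀ t, f t = c • t)
    {r : ℕ} (cs : Fin r → galH1Torsion (W.baseChange K) ((2 ^ (n + 1) : ℕ) : ℤ)) {sgn : Fin r → ℤ}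
    (hsgn : ∀ i, sgn i = 1 ∨ sgn i = -1) (hcs : ∀ i, conjAct W c ((2 ^ (n + 1) : ℕ) : ℤ) (cs i) = sgn i • cs i)
    (e : Fin r → ℕ) (he : ∀ i, ((2 : ℤ) ^ e i) • cs i = 0)
    (hind : ∀ a : Fin r → ℤ, ∑ i, a i • cs i = 0 → ∀ i, ((2 : ℤ) ^ e i) ∣ a i)
    (hres : ∀ a : Fin r → ℤ, (∀ ρ ∈ torsionFixing (W.baseChange K) ((2 ^ (n + 1) : ℕ) : ℤ),
      h1Eval (W.baseChange K) ((2 ^ (n + 1) : ℕ) : ℤ) (∑ i, a i • cs i) ρ = 0) → ∑ i, a i • cs i = 0)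
    (Nv : Fin r → ℕ) (hNe : ∀ i, Nv i ≤ e i) (heM : ∀ i, e i ≤ n + 1)
    (b : ℕ) :
    ∃ ρ : absoluteGaloisGroup K,
      (∀ X : geomTorsion W ((2 ^ (n + 1) : ℕ) : ℤ),
        (c₀ * absGaloisRestrict ℚ K ρ) • (c₀ * absGaloisRestrict ℚ K ρ) • X = X) ∧
      (∀ ζ : AlgebraicClosure ℚ, ζ ^ (2 ^ (n + 1)) = 1 → (c₀ * absGaloisRestrict ℚ K ρ) • ζ = ζ⁻¹) ∧
      (∃ P : geomTorsion W ((2 ^ (n + 1) : ℕ) : ℤ),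
        (2 : ℤ) ^ n • (P + (c₀ * absGaloisRestrict ℚ K ρ) • P) ≠ 0 ∧
        (2 : ℤ) ^ n • (P - (c₀ * absGaloisRestrict ℚ K ρ) • P) ≠ 0) ∧
      (∀ (k : ℕ) (X : geomTorsion W ((2 ^ (n + 1) : ℕ) : ℤ)), (2 : ℤ) ^ k • X = 0 →
          (c₀ * absGaloisRestrict ℚ K ρ) • X = X →
          ∃ Y : geomTorsion W ((2 ^ (n + 1) : ℕ) : ℤ),
            (2 : ℤ) ^ k • Y = 0 ∧ X = Y + (c₀ * absGaloisRestrict ℚ K ρ) • Y) ∧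
      (∀ (k : ℕ) (X : geomTorsion W ((2 ^ (n + 1) : ℕ) : ℤ)), (2 : ℤ) ^ k • X = 0 →
          (c₀ * absGaloisRestrict ℚ K ρ) • X = -X →
          ∃ Y : geomTorsion W ((2 ^ (n + 1) : ℕ) : ℤ),
            (2 : ℤ) ^ k • Y = 0 ∧ X = Y - (c₀ * absGaloisRestrict ℚ K ρ) • Y) ∧
      ∃ ℓ : ℕ, b < ℓ ∧ ℓ.Prime ∧ ¬ ℓ ∣ N ∧ ¬ ((ℓ : ℤ) ∣ NumberField.discr K) ∧ ℓ ≠ 2 ∧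
        (Ideal.span {(ℓ : 𝓞 K)}).IsPrime ∧
        (∃ (v : HeightOneSpectrum (𝓞 ℚ)) (𝔓 : Ideal (absIntegers (𝓞 ℚ) ℚ)) (h : absoluteGaloisGroup ℚ),
          (ℓ : 𝓞 ℚ) ∈ v.asIdeal ∧ 𝔓 ∈ v.primesAbove ∧ IsArithFrobAt (𝓞 ℚ) h 𝔓 ∧
          (∀ P : geomTorsion W ((2 ^ (n + 1) : ℕ) : ℤ), h • P = (c₀ * absGaloisRestrict ℚ K ρ) • P) ∧
          ∀ (e : K →ₐ[ℚ] AlgebraicClosure ℚ) (x : K), h • e x = c₀ • e x) ∧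
        2 ^ (n + 1) ∣ ℓ + 1 ∧ ((2 : ℤ) ^ (n + 1)) ∣ W.frobeniusTrace ℓ ∧
        ∀ i, ∀ v : HeightOneSpectrum (𝓞 K), (ℓ : 𝓞 K) ∈ v.asIdeal →
          (((2 : ℤ) ^ Nv i) • cs i ∈
              (W.baseChange K).torsionLocalKer (v.adicCompletion K) ((2 ^ (n + 1) : ℕ) : ℤ) ∧
            (Nv i ≠ 0 → ((2 : ℤ) ^ (Nv i - 1)) • cs i ∉
              (W.baseChange K).torsionLocalKer (v.adicCompletion K) ((2 ^ (n + 1) : ℕ) : ℤ))) := by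
  obtain ⟨ρ₀, P, hsq, hP1p, hP1m, hkerp, hkerm, hμ'⟩ := exists_regular_galoisElement_of_supply_signed (K := K) n c₀ hsup
  have hM : 1 ≤ n + 1 := by omega
  obtain ⟨ρ, hact, hsqρ, hρ⟩ := exists_galoisElement_regular_rat_signed (W := W) hK hM hc₀ hc hS hC ρ₀ hsq
    (P := P) (fun _ ↦ by simpa using hP1p) (fun _ ↦ by simpa using hP1m) (fun k X _ h1 h2 ↦ hkerp k X h1 h2)
    (fun k X _ h1 h2 ↦ hkerm k X h1 h2) hsgn hcs e he hind hres Nv hNe heM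
  have hμ : ∀ ζ : AlgebraicClosure ℚ, ζ ^ (2 ^ (n + 1)) = 1 →
      (c₀ * absGaloisRestrict ℚ K ρ) • ζ = ζ⁻¹ := hμ' _ hact
  refine ⟨ρ, hsqρ, hμ, ⟨P, ?_, ?_⟩, fun k X h1 h2 ↦ ?_, fun k X h1 h2 ↦ ?_,
    exists_kolyvaginPrime_gt_two_of_galoisElement_regular hCheb hK hM hc₀ hc cs Nv hsqρ hμ hρ b⟩
  · rw [hact]; exact hP1p
  · rw [hact]; exact hP1m
  · rw [hact] at h2
    obtain ⟨Y, hY, hXY⟩ := hkerp k X h1 h2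
    exact ⟨Y, hY, by rw [hact]; exact hXY⟩
  · rw [hact] at h2
    obtain ⟨Y, hY, hXY⟩ := hkerm k X h1 h2
    exact ⟨Y, hY, by rw [hact]; exact hXY⟩

/-- **THE REGULAR KOLYVAGIN PRIME FOR A SIGNED EIGEN FAMILY ON THE GK2 / HEEGNER FRAME** (binders `Odd d_K`, `SatisfiesHeegnerHypothesis N_E K`,
`ρ_{E,2}` and `ρ_{E,2^{n+1}}` onto — the tokens `hS`/`hC` and the full-image supply `hsup` discharged by the engine's `imageTokens_two_of_heegner` and
`exists_mul_absGaloisRestrict_smul_eq_addAut_of_heegner`).  This is the input «regular SIGNED pair-Čebotarev» of the B2Q±-frame (gk2-p5 g31) for the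
family `(res s, y)`, `sgn = (1, −1)`, once its independence is settled by socles. [cite: GrossLMS1991, §3, §9] [cite: McCallumLMS1991, §3 Cor. 3.2] -/
theorem exists_regular_kolyvaginPrime_of_heegner_signed (hCheb : Automorphic.chebotarev_artinRep) {N : ℕ}
    [NeZero N] [W.IsElliptic] [W.IsGloballyMinimal] (hK : IsImaginaryQuadratic K)
    (hodd : Odd (NumberField.discr K)) (hH : SatisfiesHeegnerHypothesis (W.conductorNorm ℤ) K) (n : ℕ)
    (hρ2 : W.HasSurjectiveModNGaloisRep 2) (hsurj : W.HasSurjectiveModNGaloisRep ((2 ^ (n + 1) : ℕ) : ℤ))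
    {c₀ : absoluteGaloisGroup ℚ} (hc₀ : IsComplexConjugation (Rat.castHom ℝ) c₀)
    {c : K ≃ₐ[ℚ] K} (hc : c ≠ 1)
    {r : ℕ} (cs : Fin r → galH1Torsion (W.baseChange K) ((2 ^ (n + 1) : ℕ) : ℤ)) {sgn : Fin r → ℤ}
    (hsgn : ∀ i, sgn i = 1 ∨ sgn i = -1) (hcs : ∀ i, conjAct W c ((2 ^ (n + 1) : ℕ) : ℤ) (cs i) = sgn i • cs i)
    (e : Fin r → ℕ) (he : ∀ i, ((2 : ℤ) ^ e i) • cs i = 0)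
    (hind : ∀ a : Fin r → ℤ, ∑ i, a i • cs i = 0 → ∀ i, ((2 : ℤ) ^ e i) ∣ a i)
    (hres : ∀ a : Fin r → ℤ, (∀ ρ ∈ torsionFixing (W.baseChange K) ((2 ^ (n + 1) : ℕ) : ℤ),
      h1Eval (W.baseChange K) ((2 ^ (n + 1) : ℕ) : ℤ) (∑ i, a i • cs i) ρ = 0) → ∑ i, a i • cs i = 0)
    (Nv : Fin r → ℕ) (hNe : ∀ i, Nv i ≤ e i) (heM : ∀ i, e i ≤ n + 1)
    (b : ℕ) :
    ∃ ρ : absoluteGaloisGroup K,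
      (∀ X : geomTorsion W ((2 ^ (n + 1) : ℕ) : ℤ),
        (c₀ * absGaloisRestrict ℚ K ρ) • (c₀ * absGaloisRestrict ℚ K ρ) • X = X) ∧
      (∀ ζ : AlgebraicClosure ℚ, ζ ^ (2 ^ (n + 1)) = 1 → (c₀ * absGaloisRestrict ℚ K ρ) • ζ = ζ⁻¹) ∧
      (∃ P : geomTorsion W ((2 ^ (n + 1) : ℕ) : ℤ),
        (2 : ℤ) ^ n • (P + (c₀ * absGaloisRestrict ℚ K ρ) • P) ≠ 0 ∧
        (2 : ℤ) ^ n • (P - (c₀ * absGaloisRestrict ℚ K ρ) • P) ≠ 0) ∧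
      (∀ (k : ℕ) (X : geomTorsion W ((2 ^ (n + 1) : ℕ) : ℤ)), (2 : ℤ) ^ k • X = 0 →
          (c₀ * absGaloisRestrict ℚ K ρ) • X = X →
          ∃ Y : geomTorsion W ((2 ^ (n + 1) : ℕ) : ℤ),
            (2 : ℤ) ^ k • Y = 0 ∧ X = Y + (c₀ * absGaloisRestrict ℚ K ρ) • Y) ∧
      (∀ (k : ℕ) (X : geomTorsion W ((2 ^ (n + 1) : ℕ) : ℤ)), (2 : ℤ) ^ k • X = 0 →
          (c₀ * absGaloisRestrict ℚ K ρ) • X = -X →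
          ∃ Y : geomTorsion W ((2 ^ (n + 1) : ℕ) : ℤ),
            (2 : ℤ) ^ k • Y = 0 ∧ X = Y - (c₀ * absGaloisRestrict ℚ K ρ) • Y) ∧
      ∃ ℓ : ℕ, b < ℓ ∧ ℓ.Prime ∧ ¬ ℓ ∣ N ∧ ¬ ((ℓ : ℤ) ∣ NumberField.discr K) ∧ ℓ ≠ 2 ∧
        (Ideal.span {(ℓ : 𝓞 K)}).IsPrime ∧
        (∃ (v : HeightOneSpectrum (𝓞 ℚ)) (𝔓 : Ideal (absIntegers (𝓞 ℚ) ℚ)) (h : absoluteGaloisGroup ℚ),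
          (ℓ : 𝓞 ℚ) ∈ v.asIdeal ∧ 𝔓 ∈ v.primesAbove ∧ IsArithFrobAt (𝓞 ℚ) h 𝔓 ∧
          (∀ P : geomTorsion W ((2 ^ (n + 1) : ℕ) : ℤ), h • P = (c₀ * absGaloisRestrict ℚ K ρ) • P) ∧
          ∀ (e : K →ₐ[ℚ] AlgebraicClosure ℚ) (x : K), h • e x = c₀ • e x) ∧
        2 ^ (n + 1) ∣ ℓ + 1 ∧ ((2 : ℤ) ^ (n + 1)) ∣ W.frobeniusTrace ℓ ∧
        ∀ i, ∀ v : HeightOneSpectrum (𝓞 K), (ℓ : 𝓞 K) ∈ v.asIdeal →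
          (((2 : ℤ) ^ Nv i) • cs i ∈
              (W.baseChange K).torsionLocalKer (v.adicCompletion K) ((2 ^ (n + 1) : ℕ) : ℤ) ∧
            (Nv i ≠ 0 → ((2 : ℤ) ^ (Nv i - 1)) • cs i ∉
              (W.baseChange K).torsionLocalKer (v.adicCompletion K) ((2 ^ (n + 1) : ℕ) : ℤ))) := by
  obtain ⟨hS, hC⟩ := imageTokens_two_of_heegner (W := W) hK hodd hH hρ2
  exact exists_regular_kolyvaginPrime_of_supply_signed hCheb hK n hc₀ (fun A ↦
    exists_mul_absGaloisRestrict_smul_eq_addAut_of_heegner hK hodd hH hsurj c₀ A) hc hS hC cs hsgn hcs e he hind hres Nv hNe heM b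

end EndToEndSigned

end Summit.BirchSwinnertonDyer.BirchSwinnertonDyer.Theorems.GenusExact.RegularSigned

end
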